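import Summits.BirchSwinnertonDyer.BirchSwinnertonDyer.Theorems.KimAtThreeFineKatoPlaceChangeExpStar
import HarnessLib

/-!
# PLACE CHANGE of Kato's DEFINED value datum: **`katoLambda … w₁ … = (1 ⊗ γ) ∘ katoLambda … w₀ …`** for one
# `γ ∈ Gal(ℚ(ζ_m)/ℚ)` with `γ • w₀ = w₁` (crux `KatoKuriharaPortThreeShared`, stmt-BirchSwinnertonDyer-19560;
# cell `bsd-addord`, seat w2-acc5 gen 7; route W2 `KimAtThreeKolyvagin`; `--supports 19560`, helper)

HONEST FRAMING.  ONE TOOL theorem (no definition, no named fact, no instance, no `sorry`); every `p`, `k`, `r`; closes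
nothing; nothing is booked; BSD / 19560 are NOT proved by any of this.

WHAT.  `katoLambda W p k r w₀ Ψ hΨ hw₀ g hg dw hinjw hexw : H¹(U_{k,r}, T_pW) →ₗ[ℤ_p] ℚ_p ⊗ ℚ(ζ_m)` (w2-acc5 gen 6,
`KimAtThreeFineKatoDefinedLambdaExpStarDefs`) is Kato's `exp* ∘ loc_p` read through ONE completion `L_{w₀}`:
`Ψ(Λ y)_w = (g̃_w⁻¹)_* (exp*_{w₀} (loc^{tower}_{w₀} (g_w · y)))`.  Its independence of the twist family `g` is
`KimAtThreeFineKatoDefinedLambdaTwist.katoLambda_eq_of_twist`.  It is NOT independent of the place: the tower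
`Γ_{L_{w₀}} → Γ_{ℚ_v} → Γ_ℚ` reads, for every `w₀`, the one prime `𝔓₀` of `ℚ̄` fixed by the closure embeddings, so that
(`KimAtThreeFineKatoPlaceChangeExpStar.expStarTowerMap_placeChange`) `exp*_{w₁} ∘ loc^{tower}_{w₁} = (γ)_* ∘ exp*_{w₀} ∘ loc^{tower}_{w₀}`
for the `γ`, `γ • w₀ = w₁`, through which the embeddings identify `L_{w₀} ≅ L_{w₁}`.  THIS FILE assembles:

* `katoLambda_placeChange` — under (RES₀) for the line data `dw₀` (at `L_{w₀}`) and `dw₁` (at `L_{w₁}`) relative to ONE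
  line datum `d` at `ℚ_v`, one class with `exp*_d ≠ 0`, ANY twist families `g₀` (for `w₀`) and `g₁` (for `w₁`):
  **∃ `γ`, `γ • w₀ = w₁`, `∀ y, katoLambda … w₁ … g₁ … dw₁ … y = (1 ⊗ γ) (katoLambda … w₀ … g₀ … dw₀ … y)`**.
  Proof: `Ψ(Λ₁ y)_w = (g̃₁,w⁻¹)_* (γ)_* F_{w₀}(g₁,w · y)` (definition + place change of `exp* ∘ loc^{tower}`);
  `F_{w₀} u = Ψ(Λ₀ u)_{w₀}` ((GAL₀) at `w₀`: kim3 `expStarOmega_galois` ∘ w2-acc5 `galD_of_galLoc` ∘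
  `singleField_gal_of_galDecomposition_all`); `Λ₀ (σ · y) = (1 ⊗ σ̃) Λ₀ y` ((C3a), `zetaBody_C3a_of_cocycleDef_of_galLoc`
  with (DEF₀) = `cocycleDef_katoLambda`); the semi-local algebra `padicTensor_map_galois` and the cocycle law of
  `galAdicCompletionMap` in the abelian group `Gal(ℚ(ζ_m)/ℚ)`.

CONSEQUENCES (for the displayed residuals of crux 19560; sequel files).  (i) A clause «`∀` charts `(w₀, g, Ψ, dw)`,
`katoLambda … (z) = 1 ⊗ x`» with `x` bound BEFORE the chart forces `γ x = x` for some `γ` moving `w₀` to any other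
`w₁ ∣ p` — degenerate when `p` has ≥ 2 places in `ℚ(ζ_m)`; (ii) the ∃-chart residual (`hKatoDef`) implies the ∀-chart
residual with `ι`, `z`, `x` chosen after the chart (`hKatoDefAllι`), by `ι ↦ ι ∘ γ⁻¹`, `x ↦ γ x`.

References: K. Kato, Astérisque 295 (2004) §9.4, Thm. 9.7 [Kato2004Asterisque]; K. Kato, LNM 1553 (1993) II §1.2.4,
Prop. 1.2.3 [Kato1993LNM1553]; J. Neukirch, *ANT* (1999) I §9, II §9 (9.6) [NeukirchANT1999]; J. W. S. Cassels,
A. Fröhlich (1967) Ch. II §10 (10.2), Ch. VII §1.1 [CasselsFrohlichANT1967]; J.-P. Serre, *Galois Cohomology* (1997) I §2.4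
[SerreGaloisCohomology1997].
-/

noncomputable section

-- the cell's Theorems namespace `Summit.BirchSwinnertonDyer.BirchSwinnertonDyer.…` repeats the summit name by design (D-0017)
set_option linter.dupNamespace false

open scoped Classical NumberField ContRepresentation TensorProduct Pointwise
open Field ValuativeRel NumberField IsDedekindDomain
open WeierstrassCurve Literature.NumberTheory.EllipticCurves Literature.NumberTheory.GaloisRepresentations
  Literature.NumberTheory.GaloisRepresentations.DiscreteGaloisModule
  Literature.NumberTheory.EllipticCurves.Kato2004.EulerSystemValues
open Literature.NumberTheory.GaloisRepresentations.PeriodRingData Literature.NumberTheory.PAdicHodge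
open Literature.NumberTheory.AdelicBaseChange Literature.NumberTheory.Automorphic
open Summit.BirchSwinnertonDyer.Rank1Residual.GaloisImage
open Summit.BirchSwinnertonDyer.BirchSwinnertonDyer.Theorems.KimAtThreeFineKatoLevelCompat
open Summit.BirchSwinnertonDyer.BirchSwinnertonDyer.Theorems.KimAtThreeFineKatoLevelCompatDef
open Summit.BirchSwinnertonDyer.BirchSwinnertonDyer.Theorems.KimAtThreeDeepLowerExpStarOmega
open Summit.BirchSwinnertonDyer.BirchSwinnertonDyer.Theorems.KimAtThreeDeepLowerExpStarOmegaPlace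
open Summit.BirchSwinnertonDyer.BirchSwinnertonDyer.Theorems.KimAtThreeDeepLowerExpStarOmegaRes
open Summit.BirchSwinnertonDyer.BirchSwinnertonDyer.Theorems.KimAtThreeFineKatoExpStarGalois
open Summit.BirchSwinnertonDyer.BirchSwinnertonDyer.Theorems.KimAtThreeFineKatoValueEquivarianceStabAll
open Summit.BirchSwinnertonDyer.BirchSwinnertonDyer.Theorems.KimAtThreeFineKatoValueEquivarianceLocal
open Summit.BirchSwinnertonDyer.BirchSwinnertonDyer.Theorems.KimAtThreeFineKatoDefinedLambda
open Summit.BirchSwinnertonDyer.BirchSwinnertonDyer.Theorems.KimAtThreeFineKatoPlaceChangeGalois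
open Summit.BirchSwinnertonDyer.BirchSwinnertonDyer.Theorems.KimAtThreeFineKatoPlaceChangeExpStar

namespace Summit.BirchSwinnertonDyer.BirchSwinnertonDyer.Theorems.KimAtThreeFineKatoPlaceChange

/-! ## §1. The semi-local algebra: place change from the components (clean context) -/

section Components

variable (W : WeierstrassCurve ℚ) [W.IsElliptic] (p : ℕ) [hp : Fact p.Prime]
  [ContinuousSMul ℤ_[p] (W.tateModule p)] (k : ℕ) (r : Finset (HeightOneSpectrum (𝓞 ℚ)))
  (Ψ : ℚ_[p] ⊗[ℚ] CyclotomicField (cycLevel p k r) ℚ ≃ₐ[ℚ]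
    (Π w : ((Rat.HeightOneSpectrum.primesEquiv (R := 𝓞 ℚ)).symm ⟨p, Fact.out⟩).Extension (𝓞 (CyclotomicField (cycLevel p k r) ℚ)), w.1.adicCompletion (CyclotomicField (cycLevel p k r) ℚ)))
  (hΨ : ∀ (s : ℚ_[p]) (x : CyclotomicField (cycLevel p k r) ℚ) (w : ((Rat.HeightOneSpectrum.primesEquiv (R := 𝓞 ℚ)).symm ⟨p, Fact.out⟩).Extension (𝓞 (CyclotomicField (cycLevel p k r) ℚ))),
    Ψ (s ⊗ₜ[ℚ] x) w = algebraMap (CyclotomicField (cycLevel p k r) ℚ) (w.1.adicCompletion (CyclotomicField (cycLevel p k r) ℚ)) x *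
      algebraMap (((Rat.HeightOneSpectrum.primesEquiv (R := 𝓞 ℚ)).symm ⟨p, Fact.out⟩).adicCompletion ℚ) (w.1.adicCompletion (CyclotomicField (cycLevel p k r) ℚ)) (Padic.adicCompletionEquiv (𝓞 ℚ) ⟨p, Fact.out⟩ s))
  (w₀ w₁ : ((Rat.HeightOneSpectrum.primesEquiv (R := 𝓞 ℚ)).symm ⟨p, Fact.out⟩).Extension (𝓞 (CyclotomicField (cycLevel p k r) ℚ)))
  (g₀ : ((Rat.HeightOneSpectrum.primesEquiv (R := 𝓞 ℚ)).symm ⟨p, Fact.out⟩).Extension (𝓞 (CyclotomicField (cycLevel p k r) ℚ)) → absoluteGaloisGroup ℚ)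
  (hg₀ : ∀ w : ((Rat.HeightOneSpectrum.primesEquiv (R := 𝓞 ℚ)).symm ⟨p, Fact.out⟩).Extension (𝓞 (CyclotomicField (cycLevel p k r) ℚ)), sigma (cycLevel p k r) (modNCyclotomicCharacter ℚ (cycLevel p k r) (g₀ w)) • w.1 = w₀.1)
  (g₁ : ((Rat.HeightOneSpectrum.primesEquiv (R := 𝓞 ℚ)).symm ⟨p, Fact.out⟩).Extension (𝓞 (CyclotomicField (cycLevel p k r) ℚ)) → absoluteGaloisGroup ℚ)
  (hg₁ : ∀ w : ((Rat.HeightOneSpectrum.primesEquiv (R := 𝓞 ℚ)).symm ⟨p, Fact.out⟩).Extension (𝓞 (CyclotomicField (cycLevel p k r) ℚ)), sigma (cycLevel p k r) (modNCyclotomicCharacter ℚ (cycLevel p k r) (g₁ w)) • w.1 = w₁.1)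

include hΨ in
set_option backward.isDefEq.respectTransparency false in
/-- **Place change from the components** (pure semi-local algebra, every `p`): if `Λ₀`, `Λ₁` are read through `w₀`, `w₁`
from additive `F₀`, `F₁` and twist families `g₀`, `g₁` ((DEF₀) at class level), `F₀` is (GAL₀)-equivariant at `w₀`,
`Λ₀` satisfies (C3a), and `F₁ = (γ)_* ∘ F₀` with `γ • w₀ = w₁`, then `Λ₁ = (1 ⊗ γ) ∘ Λ₀` (`padicTensor_map_galois` and the
cocycle law of `galAdicCompletionMap` in the abelian `Gal(ℚ(ζ_m)/ℚ)`).
[cite: CasselsFrohlichANT1967, Ch. II §10 Theorem (10.2) and Ch. VII §1.1] [cite: Kato2004Asterisque, §9.4 (p. 188)] -/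
theorem eq_map_of_components
    (F₀ : H1 (tateRep W p) (cycSubgroup p k r) →+ (w₀.1.adicCompletion (CyclotomicField (cycLevel p k r) ℚ))) (F₁ : H1 (tateRep W p) (cycSubgroup p k r) →+ (w₁.1.adicCompletion (CyclotomicField (cycLevel p k r) ℚ)))
    (Λ₀ Λ₁ : H1 (tateRep W p) (cycSubgroup p k r) →ₗ[ℤ_[p]] ℚ_[p] ⊗[ℚ] CyclotomicField (cycLevel p k r) ℚ)
    (hΛ₀ : ∀ (y : H1 (tateRep W p) (cycSubgroup p k r)) (w : ((Rat.HeightOneSpectrum.primesEquiv (R := 𝓞 ℚ)).symm ⟨p, Fact.out⟩).Extension (𝓞 (CyclotomicField (cycLevel p k r) ℚ))),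
      Ψ (Λ₀ y) w = galAdicCompletionMap (sigma (cycLevel p k r) (modNCyclotomicCharacter ℚ (cycLevel p k r) (g₀ w)))⁻¹
        (inv_smul_eq_of_smul_eq (hg₀ w)) (F₀ (conjMap (tateRep W p).toTopRep (cycSubgroup p k r) (g₀ w) 1 y)))
    (hΛ₁ : ∀ (y : H1 (tateRep W p) (cycSubgroup p k r)) (w : ((Rat.HeightOneSpectrum.primesEquiv (R := 𝓞 ℚ)).symm ⟨p, Fact.out⟩).Extension (𝓞 (CyclotomicField (cycLevel p k r) ℚ))),
      Ψ (Λ₁ y) w = galAdicCompletionMap (sigma (cycLevel p k r) (modNCyclotomicCharacter ℚ (cycLevel p k r) (g₁ w)))⁻¹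
        (inv_smul_eq_of_smul_eq (hg₁ w)) (F₁ (conjMap (tateRep W p).toTopRep (cycSubgroup p k r) (g₁ w) 1 y)))
    (hGAL₀ : ∀ (δ : absoluteGaloisGroup ℚ)
      (hδ : sigma (cycLevel p k r) (modNCyclotomicCharacter ℚ (cycLevel p k r) δ) • w₀.1 = w₀.1)
      (Y : H1 (tateRep W p) (cycSubgroup p k r)),
      F₀ (conjMap (tateRep W p).toTopRep (cycSubgroup p k r) δ 1 Y) =
        galAdicCompletionMap (sigma (cycLevel p k r) (modNCyclotomicCharacter ℚ (cycLevel p k r) δ)) hδ (F₀ Y))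
    (hC3a : ∀ (σ : absoluteGaloisGroup ℚ) (y : H1 (tateRep W p) (cycSubgroup p k r)),
      Λ₀ (conjMap (tateRep W p).toTopRep (cycSubgroup p k r) σ 1 y) =
        Algebra.TensorProduct.map (AlgHom.id ℚ ℚ_[p])
          (sigma (cycLevel p k r) (modNCyclotomicCharacter ℚ (cycLevel p k r) σ) :
            CyclotomicField (cycLevel p k r) ℚ →ₐ[ℚ] CyclotomicField (cycLevel p k r) ℚ) (Λ₀ y))
    (γ : CyclotomicField (cycLevel p k r) ℚ ≃ₐ[ℚ] CyclotomicField (cycLevel p k r) ℚ) (hγ : γ • w₀.1 = w₁.1)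
    (hF : ∀ Y : H1 (tateRep W p) (cycSubgroup p k r), F₁ Y = galAdicCompletionMap γ hγ (F₀ Y))
    (y : H1 (tateRep W p) (cycSubgroup p k r)) :
    Λ₁ y = Algebra.TensorProduct.map (AlgHom.id ℚ ℚ_[p])
      (γ : CyclotomicField (cycLevel p k r) ℚ →ₐ[ℚ] CyclotomicField (cycLevel p k r) ℚ) (Λ₀ y) := by
  haveI := IsCyclotomicExtension.isGalois {cycLevel p k r} ℚ (CyclotomicField (cycLevel p k r) ℚ)
  -- `F₀ u = Ψ (Λ₀ u)_{w₀}`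
  have hF₀Ψ : ∀ u : H1 (tateRep W p) (cycSubgroup p k r), F₀ u = Ψ (Λ₀ u) w₀ := fun u => by
    rw [hΛ₀ u w₀, hGAL₀ (g₀ w₀) (hg₀ w₀) u, galAdicCompletionMap_inv_apply]
  apply Ψ.injective
  funext w
  -- the source factor `wγ := γ⁻¹ • w`; `g̃₁,w` sends it to `w₀`, `γ` to `w`
  let wγ : ((Rat.HeightOneSpectrum.primesEquiv (R := 𝓞 ℚ)).symm ⟨p, Fact.out⟩).Extension (𝓞 (CyclotomicField (cycLevel p k r) ℚ)) :=
    ⟨γ⁻¹ • w.1, by rw [HeightOneSpectrum.under_algEquiv_smul]; exact w.2⟩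
  have hσw₀ : (sigma (cycLevel p k r) (modNCyclotomicCharacter ℚ (cycLevel p k r) (g₁ w))) • wγ.1 = w₀.1 := by
    change (sigma (cycLevel p k r) (modNCyclotomicCharacter ℚ (cycLevel p k r) (g₁ w))) • γ⁻¹ • w.1 = w₀.1
    rw [smul_smul, CyclotomicField.algEquiv_mul_comm (sigma (cycLevel p k r) (modNCyclotomicCharacter ℚ (cycLevel p k r) (g₁ w))) γ⁻¹, ← smul_smul, hg₁ w, ← hγ, inv_smul_smul]
  have hγw : γ • wγ.1 = w.1 := smul_inv_smul γ w.1
  have hP₁ : Ψ (Algebra.TensorProduct.map (AlgHom.id ℚ ℚ_[p])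
      ((sigma (cycLevel p k r) (modNCyclotomicCharacter ℚ (cycLevel p k r) (g₁ w))) : CyclotomicField (cycLevel p k r) ℚ →ₐ[ℚ] CyclotomicField (cycLevel p k r) ℚ) (Λ₀ y)) w₀ =
      galAdicCompletionMap (sigma (cycLevel p k r) (modNCyclotomicCharacter ℚ (cycLevel p k r) (g₁ w))) hσw₀ (Ψ (Λ₀ y) wγ) :=
    padicTensor_map_galois Ψ.toAlgHom hΨ (sigma (cycLevel p k r) (modNCyclotomicCharacter ℚ (cycLevel p k r) (g₁ w))) wγ w₀ hσw₀ (Λ₀ y)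
  have hP₂ : Ψ (Algebra.TensorProduct.map (AlgHom.id ℚ ℚ_[p])
      (γ : CyclotomicField (cycLevel p k r) ℚ →ₐ[ℚ] CyclotomicField (cycLevel p k r) ℚ) (Λ₀ y)) w =
      galAdicCompletionMap γ hγw (Ψ (Λ₀ y) wγ) :=
    padicTensor_map_galois Ψ.toAlgHom hΨ γ wγ w hγw (Λ₀ y)
  rw [hΛ₁ y w, hF, hF₀Ψ, hC3a (g₁ w) y, hP₁, hP₂, galAdicCompletionMap_galAdicCompletionMap,
    galAdicCompletionMap_galAdicCompletionMap]
  refine galAdicCompletionMap_congr_left _ ?_ _ _ _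
  rw [mul_assoc, CyclotomicField.algEquiv_mul_comm γ (sigma (cycLevel p k r) (modNCyclotomicCharacter ℚ (cycLevel p k r) (g₁ w))), ← mul_assoc, inv_mul_cancel, one_mul]

end Components

/-! ## §2. Place change of `katoLambda` -/

section PlaceChange

variable (W : WeierstrassCurve ℚ) [W.IsElliptic] (p : ℕ) [hp : Fact p.Prime]
  [ContinuousSMul ℤ_[p] (W.tateModule p)] (k : ℕ) (r : Finset (HeightOneSpectrum (𝓞 ℚ)))
  (Ψ : ℚ_[p] ⊗[ℚ] CyclotomicField (cycLevel p k r) ℚ ≃ₐ[ℚ]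
    (Π w : ((Rat.HeightOneSpectrum.primesEquiv (R := 𝓞 ℚ)).symm ⟨p, Fact.out⟩).Extension (𝓞 (CyclotomicField (cycLevel p k r) ℚ)), w.1.adicCompletion (CyclotomicField (cycLevel p k r) ℚ)))
  (hΨ : ∀ (s : ℚ_[p]) (x : CyclotomicField (cycLevel p k r) ℚ) (w : ((Rat.HeightOneSpectrum.primesEquiv (R := 𝓞 ℚ)).symm ⟨p, Fact.out⟩).Extension (𝓞 (CyclotomicField (cycLevel p k r) ℚ))),
    Ψ (s ⊗ₜ[ℚ] x) w = algebraMap (CyclotomicField (cycLevel p k r) ℚ) (w.1.adicCompletion (CyclotomicField (cycLevel p k r) ℚ)) x *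
      algebraMap (((Rat.HeightOneSpectrum.primesEquiv (R := 𝓞 ℚ)).symm ⟨p, Fact.out⟩).adicCompletion ℚ) (w.1.adicCompletion (CyclotomicField (cycLevel p k r) ℚ)) (Padic.adicCompletionEquiv (𝓞 ℚ) ⟨p, Fact.out⟩ s))
  (w₀ w₁ : ((Rat.HeightOneSpectrum.primesEquiv (R := 𝓞 ℚ)).symm ⟨p, Fact.out⟩).Extension (𝓞 (CyclotomicField (cycLevel p k r) ℚ)))
  (hw₀ : ((p : ℕ) : 𝓞 (CyclotomicField (cycLevel p k r) ℚ)) ∈ w₀.1.asIdeal)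
  (hw₁ : ((p : ℕ) : 𝓞 (CyclotomicField (cycLevel p k r) ℚ)) ∈ w₁.1.asIdeal)
  (g₀ : ((Rat.HeightOneSpectrum.primesEquiv (R := 𝓞 ℚ)).symm ⟨p, Fact.out⟩).Extension (𝓞 (CyclotomicField (cycLevel p k r) ℚ)) → absoluteGaloisGroup ℚ)
  (hg₀ : ∀ w : ((Rat.HeightOneSpectrum.primesEquiv (R := 𝓞 ℚ)).symm ⟨p, Fact.out⟩).Extension (𝓞 (CyclotomicField (cycLevel p k r) ℚ)), sigma (cycLevel p k r) (modNCyclotomicCharacter ℚ (cycLevel p k r) (g₀ w)) • w.1 = w₀.1)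
  (g₁ : ((Rat.HeightOneSpectrum.primesEquiv (R := 𝓞 ℚ)).symm ⟨p, Fact.out⟩).Extension (𝓞 (CyclotomicField (cycLevel p k r) ℚ)) → absoluteGaloisGroup ℚ)
  (hg₁ : ∀ w : ((Rat.HeightOneSpectrum.primesEquiv (R := 𝓞 ℚ)).symm ⟨p, Fact.out⟩).Extension (𝓞 (CyclotomicField (cycLevel p k r) ℚ)), sigma (cycLevel p k r) (modNCyclotomicCharacter ℚ (cycLevel p k r) (g₁ w)) • w.1 = w₁.1)

set_option backward.isDefEq.respectTransparency false in
set_option maxHeartbeats 1600000 in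
/-- **Place change of Kato's defined value datum** (module docstring): `katoLambda … w₁ … = (1 ⊗ γ) ∘ katoLambda … w₀ …`
for one `γ ∈ Gal(ℚ(ζ_m)/ℚ)` with `γ • w₀ = w₁`, under (RES₀) at both places relative to one line datum `d` at `ℚ_v` and one
class with `exp*_d ≠ 0` (`maxHeartbeats 1600000`: two displayed chart blocks, the (GAL₀)/(C3a) instantiation at `w₀` and
the place change of `exp* ∘ loc^{tower}` in one proof).
[cite: Kato2004Asterisque, §9.4 (p. 188) and Thm. 9.7 (p. 189)] [cite: Kato1993LNM1553, Ch. II §1.2.4 and Prop. 1.2.3]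
[cite: NeukirchANT1999, Ch. I §9 and Ch. II §9 Prop. (9.6)] [cite: CasselsFrohlichANT1967, Ch. II §10 Theorem (10.2) and Ch. VII §1.1] -/
theorem katoLambda_placeChange :
    haveI : Fact (((p : ℕ) : 𝓞 ℚ) ∈ ((Rat.HeightOneSpectrum.primesEquiv (R := 𝓞 ℚ)).symm ⟨p, Fact.out⟩).asIdeal) := ⟨(natCast_mem_asIdeal_iff_eq_primesEquiv_symm _ hp.out).mpr rfl⟩
    letI := valuativeRelPlace ((Rat.HeightOneSpectrum.primesEquiv (R := 𝓞 ℚ)).symm ⟨p, Fact.out⟩)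
    letI := topologicalSpacePlace ((Rat.HeightOneSpectrum.primesEquiv (R := 𝓞 ℚ)).symm ⟨p, Fact.out⟩)
    haveI := isNonarchimedeanLocalField_place ((Rat.HeightOneSpectrum.primesEquiv (R := 𝓞 ℚ)).symm ⟨p, Fact.out⟩)
    haveI := charZero_place ((Rat.HeightOneSpectrum.primesEquiv (R := 𝓞 ℚ)).symm ⟨p, Fact.out⟩)
    letI := padicAlgebraPlace p ((Rat.HeightOneSpectrum.primesEquiv (R := 𝓞 ℚ)).symm ⟨p, Fact.out⟩)
    haveI := fact_not_isUnit_place p ((Rat.HeightOneSpectrum.primesEquiv (R := 𝓞 ℚ)).symm ⟨p, Fact.out⟩)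
    haveI := isAdicComplete_place p ((Rat.HeightOneSpectrum.primesEquiv (R := 𝓞 ℚ)).symm ⟨p, Fact.out⟩)
    ∀ (d : LocalNeronLineAt W p ((Rat.HeightOneSpectrum.primesEquiv (R := 𝓞 ℚ)).symm ⟨p, Fact.out⟩))
      (hinj : (bdRPeriodRingData (valuation_place_lt_one p ((Rat.HeightOneSpectrum.primesEquiv (R := 𝓞 ℚ)).symm ⟨p, Fact.out⟩))).CupLogInjective (logCyclotomic p)
        (localRationalTateRep W p (galRestrictPlace ((Rat.HeightOneSpectrum.primesEquiv (R := 𝓞 ℚ)).symm ⟨p, Fact.out⟩))))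
      (hex : ∀ z : contOneCocycles (localRationalTateRep W p (galRestrictPlace ((Rat.HeightOneSpectrum.primesEquiv (R := 𝓞 ℚ)).symm ⟨p, Fact.out⟩))).toTopRep,
        (bdRPeriodRingData (valuation_place_lt_one p ((Rat.HeightOneSpectrum.primesEquiv (R := 𝓞 ℚ)).symm ⟨p, Fact.out⟩))).HasDualExp (logCyclotomic p)
          (localRationalTateRep W p (galRestrictPlace ((Rat.HeightOneSpectrum.primesEquiv (R := 𝓞 ℚ)).symm ⟨p, Fact.out⟩))) fun σ => z.1 σ),
    (∃ y, expStarOmegaAt d y ≠ 0) →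
    letI := LocalField.charZero_adicCompletion w₀.1
    letI := LocalField.adicCompletionPadicAlgebra w₀.1 p hw₀
    haveI : Fact (¬ IsUnit ((p : ℕ) : integerC (w₀.1.adicCompletion (CyclotomicField (cycLevel p k r) ℚ)))) := ⟨not_isUnit_natCast_integerC (LocalField.valuation_adicCompletion_natCast_lt_one w₀.1 p hw₀)⟩
    haveI := isAdicComplete_integerC_natCast (LocalField.valuation_adicCompletion_natCast_lt_one w₀.1 p hw₀)
    ∀ (dw₀ : LocalNeronLine W (LocalField.valuation_adicCompletion_natCast_lt_one w₀.1 p hw₀) ((galRestrictPlace ((Rat.HeightOneSpectrum.primesEquiv (R := 𝓞 ℚ)).symm ⟨p, Fact.out⟩)).comp (absGaloisRestrict (((Rat.HeightOneSpectrum.primesEquiv (R := 𝓞 ℚ)).symm ⟨p, Fact.out⟩).adicCompletion ℚ) (w₀.1.adicCompletion (CyclotomicField (cycLevel p k r) ℚ)))))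
      (hinjw₀ : (bdRPeriodRingData (LocalField.valuation_adicCompletion_natCast_lt_one w₀.1 p hw₀)).CupLogInjective (logCyclotomic p) (localRationalTateRep W p ((galRestrictPlace ((Rat.HeightOneSpectrum.primesEquiv (R := 𝓞 ℚ)).symm ⟨p, Fact.out⟩)).comp (absGaloisRestrict (((Rat.HeightOneSpectrum.primesEquiv (R := 𝓞 ℚ)).symm ⟨p, Fact.out⟩).adicCompletion ℚ) (w₀.1.adicCompletion (CyclotomicField (cycLevel p k r) ℚ))))))
      (hexw₀ : ∀ z : contOneCocycles (localRationalTateRep W p ((galRestrictPlace ((Rat.HeightOneSpectrum.primesEquiv (R := 𝓞 ℚ)).symm ⟨p, Fact.out⟩)).comp (absGaloisRestrict (((Rat.HeightOneSpectrum.primesEquiv (R := 𝓞 ℚ)).symm ⟨p, Fact.out⟩).adicCompletion ℚ) (w₀.1.adicCompletion (CyclotomicField (cycLevel p k r) ℚ))))).toTopRep,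
        (bdRPeriodRingData (LocalField.valuation_adicCompletion_natCast_lt_one w₀.1 p hw₀)).HasDualExp (logCyclotomic p) (localRationalTateRep W p ((galRestrictPlace ((Rat.HeightOneSpectrum.primesEquiv (R := 𝓞 ℚ)).symm ⟨p, Fact.out⟩)).comp (absGaloisRestrict (((Rat.HeightOneSpectrum.primesEquiv (R := 𝓞 ℚ)).symm ⟨p, Fact.out⟩).adicCompletion ℚ) (w₀.1.adicCompletion (CyclotomicField (cycLevel p k r) ℚ))))) fun σ => z.1 σ),
    (∀ (h : (tateLocalRep W p (Sum.inr ((Rat.HeightOneSpectrum.primesEquiv (R := 𝓞 ℚ)).symm ⟨p, Fact.out⟩))).cohomology 1),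
      expStarOmegaHom (LocalField.valuation_adicCompletion_natCast_lt_one w₀.1 p hw₀) ((galRestrictPlace ((Rat.HeightOneSpectrum.primesEquiv (R := 𝓞 ℚ)).symm ⟨p, Fact.out⟩)).comp (absGaloisRestrict (((Rat.HeightOneSpectrum.primesEquiv (R := 𝓞 ℚ)).symm ⟨p, Fact.out⟩).adicCompletion ℚ) (w₀.1.adicCompletion (CyclotomicField (cycLevel p k r) ℚ)))) dw₀ hinjw₀ hexw₀
        (ContinuousRep.cohomologyRes (tateLocalRep W p (Sum.inr ((Rat.HeightOneSpectrum.primesEquiv (R := 𝓞 ℚ)).symm ⟨p, Fact.out⟩))) (absGaloisRestrict (((Rat.HeightOneSpectrum.primesEquiv (R := 𝓞 ℚ)).symm ⟨p, Fact.out⟩).adicCompletion ℚ) (w₀.1.adicCompletion (CyclotomicField (cycLevel p k r) ℚ))) 1 h) =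
      algebraMap (((Rat.HeightOneSpectrum.primesEquiv (R := 𝓞 ℚ)).symm ⟨p, Fact.out⟩).adicCompletion ℚ) (w₀.1.adicCompletion (CyclotomicField (cycLevel p k r) ℚ)) (expStarOmegaAt d h)) →
    letI := LocalField.charZero_adicCompletion w₁.1
    letI := LocalField.adicCompletionPadicAlgebra w₁.1 p hw₁
    haveI : Fact (¬ IsUnit ((p : ℕ) : integerC (w₁.1.adicCompletion (CyclotomicField (cycLevel p k r) ℚ)))) := ⟨not_isUnit_natCast_integerC (LocalField.valuation_adicCompletion_natCast_lt_one w₁.1 p hw₁)⟩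
    haveI := isAdicComplete_integerC_natCast (LocalField.valuation_adicCompletion_natCast_lt_one w₁.1 p hw₁)
    ∀ (dw₁ : LocalNeronLine W (LocalField.valuation_adicCompletion_natCast_lt_one w₁.1 p hw₁) ((galRestrictPlace ((Rat.HeightOneSpectrum.primesEquiv (R := 𝓞 ℚ)).symm ⟨p, Fact.out⟩)).comp (absGaloisRestrict (((Rat.HeightOneSpectrum.primesEquiv (R := 𝓞 ℚ)).symm ⟨p, Fact.out⟩).adicCompletion ℚ) (w₁.1.adicCompletion (CyclotomicField (cycLevel p k r) ℚ)))))
      (hinjw₁ : (bdRPeriodRingData (LocalField.valuation_adicCompletion_natCast_lt_one w₁.1 p hw₁)).CupLogInjective (logCyclotomic p) (localRationalTateRep W p ((galRestrictPlace ((Rat.HeightOneSpectrum.primesEquiv (R := 𝓞 ℚ)).symm ⟨p, Fact.out⟩)).comp (absGaloisRestrict (((Rat.HeightOneSpectrum.primesEquiv (R := 𝓞 ℚ)).symm ⟨p, Fact.out⟩).adicCompletion ℚ) (w₁.1.adicCompletion (CyclotomicField (cycLevel p k r) ℚ))))))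
      (hexw₁ : ∀ z : contOneCocycles (localRationalTateRep W p ((galRestrictPlace ((Rat.HeightOneSpectrum.primesEquiv (R := 𝓞 ℚ)).symm ⟨p, Fact.out⟩)).comp (absGaloisRestrict (((Rat.HeightOneSpectrum.primesEquiv (R := 𝓞 ℚ)).symm ⟨p, Fact.out⟩).adicCompletion ℚ) (w₁.1.adicCompletion (CyclotomicField (cycLevel p k r) ℚ))))).toTopRep,
        (bdRPeriodRingData (LocalField.valuation_adicCompletion_natCast_lt_one w₁.1 p hw₁)).HasDualExp (logCyclotomic p) (localRationalTateRep W p ((galRestrictPlace ((Rat.HeightOneSpectrum.primesEquiv (R := 𝓞 ℚ)).symm ⟨p, Fact.out⟩)).comp (absGaloisRestrict (((Rat.HeightOneSpectrum.primesEquiv (R := 𝓞 ℚ)).symm ⟨p, Fact.out⟩).adicCompletion ℚ) (w₁.1.adicCompletion (CyclotomicField (cycLevel p k r) ℚ))))) fun σ => z.1 σ),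
    (∀ (h : (tateLocalRep W p (Sum.inr ((Rat.HeightOneSpectrum.primesEquiv (R := 𝓞 ℚ)).symm ⟨p, Fact.out⟩))).cohomology 1),
      expStarOmegaHom (LocalField.valuation_adicCompletion_natCast_lt_one w₁.1 p hw₁) ((galRestrictPlace ((Rat.HeightOneSpectrum.primesEquiv (R := 𝓞 ℚ)).symm ⟨p, Fact.out⟩)).comp (absGaloisRestrict (((Rat.HeightOneSpectrum.primesEquiv (R := 𝓞 ℚ)).symm ⟨p, Fact.out⟩).adicCompletion ℚ) (w₁.1.adicCompletion (CyclotomicField (cycLevel p k r) ℚ)))) dw₁ hinjw₁ hexw₁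
        (ContinuousRep.cohomologyRes (tateLocalRep W p (Sum.inr ((Rat.HeightOneSpectrum.primesEquiv (R := 𝓞 ℚ)).symm ⟨p, Fact.out⟩))) (absGaloisRestrict (((Rat.HeightOneSpectrum.primesEquiv (R := 𝓞 ℚ)).symm ⟨p, Fact.out⟩).adicCompletion ℚ) (w₁.1.adicCompletion (CyclotomicField (cycLevel p k r) ℚ))) 1 h) =
      algebraMap (((Rat.HeightOneSpectrum.primesEquiv (R := 𝓞 ℚ)).symm ⟨p, Fact.out⟩).adicCompletion ℚ) (w₁.1.adicCompletion (CyclotomicField (cycLevel p k r) ℚ)) (expStarOmegaAt d h)) →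
    ∃ (γ : CyclotomicField (cycLevel p k r) ℚ ≃ₐ[ℚ] CyclotomicField (cycLevel p k r) ℚ) (_ : γ • w₀.1 = w₁.1),
      ∀ y : H1 (tateRep W p) (cycSubgroup p k r),
        katoLambda W p k r w₁ Ψ hΨ hw₁ g₁ hg₁ dw₁ hinjw₁ hexw₁ y =
          Algebra.TensorProduct.map (AlgHom.id ℚ ℚ_[p])
            (γ : CyclotomicField (cycLevel p k r) ℚ →ₐ[ℚ] CyclotomicField (cycLevel p k r) ℚ)
            (katoLambda W p k r w₀ Ψ hΨ hw₀ g₀ hg₀ dw₀ hinjw₀ hexw₀ y) := by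
  haveI : Fact (((p : ℕ) : 𝓞 ℚ) ∈ ((Rat.HeightOneSpectrum.primesEquiv (R := 𝓞 ℚ)).symm ⟨p, Fact.out⟩).asIdeal) := ⟨(natCast_mem_asIdeal_iff_eq_primesEquiv_symm _ hp.out).mpr rfl⟩
  letI := valuativeRelPlace ((Rat.HeightOneSpectrum.primesEquiv (R := 𝓞 ℚ)).symm ⟨p, Fact.out⟩)
  letI := topologicalSpacePlace ((Rat.HeightOneSpectrum.primesEquiv (R := 𝓞 ℚ)).symm ⟨p, Fact.out⟩)
  haveI := isNonarchimedeanLocalField_place ((Rat.HeightOneSpectrum.primesEquiv (R := 𝓞 ℚ)).symm ⟨p, Fact.out⟩)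
  haveI := charZero_place ((Rat.HeightOneSpectrum.primesEquiv (R := 𝓞 ℚ)).symm ⟨p, Fact.out⟩)
  letI := padicAlgebraPlace p ((Rat.HeightOneSpectrum.primesEquiv (R := 𝓞 ℚ)).symm ⟨p, Fact.out⟩)
  haveI := fact_not_isUnit_place p ((Rat.HeightOneSpectrum.primesEquiv (R := 𝓞 ℚ)).symm ⟨p, Fact.out⟩)
  haveI := isAdicComplete_place p ((Rat.HeightOneSpectrum.primesEquiv (R := 𝓞 ℚ)).symm ⟨p, Fact.out⟩)
  intro d hinj hex hne
  letI := LocalField.charZero_adicCompletion w₀.1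
  letI := LocalField.adicCompletionPadicAlgebra w₀.1 p hw₀
  haveI : Fact (¬ IsUnit ((p : ℕ) : integerC (w₀.1.adicCompletion (CyclotomicField (cycLevel p k r) ℚ)))) := ⟨not_isUnit_natCast_integerC (LocalField.valuation_adicCompletion_natCast_lt_one w₀.1 p hw₀)⟩
  haveI := isAdicComplete_integerC_natCast (LocalField.valuation_adicCompletion_natCast_lt_one w₀.1 p hw₀)
  intro dw₀ hinjw₀ hexw₀ hres₀
  letI := LocalField.charZero_adicCompletion w₁.1
  letI := LocalField.adicCompletionPadicAlgebra w₁.1 p hw₁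
  haveI : Fact (¬ IsUnit ((p : ℕ) : integerC (w₁.1.adicCompletion (CyclotomicField (cycLevel p k r) ℚ)))) := ⟨not_isUnit_natCast_integerC (LocalField.valuation_adicCompletion_natCast_lt_one w₁.1 p hw₁)⟩
  haveI := isAdicComplete_integerC_natCast (LocalField.valuation_adicCompletion_natCast_lt_one w₁.1 p hw₁)
  intro dw₁ hinjw₁ hexw₁ hres₁
  -- `Place.Completion (inr v)` IS `ℚ_v`: the packet's algebra structure on it
  letI instEF₀ : Algebra (NumberField.Place.Completion (K := ℚ) (Sum.inr ((Rat.HeightOneSpectrum.primesEquiv (R := 𝓞 ℚ)).symm ⟨p, Fact.out⟩))) (w₀.1.adicCompletion (CyclotomicField (cycLevel p k r) ℚ)) := inferInstanceAs (Algebra (((Rat.HeightOneSpectrum.primesEquiv (R := 𝓞 ℚ)).symm ⟨p, Fact.out⟩).adicCompletion ℚ) (w₀.1.adicCompletion (CyclotomicField (cycLevel p k r) ℚ)))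
  haveI hGal₀ : IsGalois (NumberField.Place.Completion (K := ℚ) (Sum.inr ((Rat.HeightOneSpectrum.primesEquiv (R := 𝓞 ℚ)).symm ⟨p, Fact.out⟩))) (w₀.1.adicCompletion (CyclotomicField (cycLevel p k r) ℚ)) :=
    isGalois_adicCompletion_cyclotomicField (cycLevel p k r) ((Rat.HeightOneSpectrum.primesEquiv (R := 𝓞 ℚ)).symm ⟨p, Fact.out⟩) w₀
  have hconj := fun δ' : absoluteGaloisGroup (NumberField.Place.Completion (K := ℚ) (Sum.inr ((Rat.HeightOneSpectrum.primesEquiv (R := 𝓞 ℚ)).symm ⟨p, Fact.out⟩))) =>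
    exists_conjTransport (K := NumberField.Place.Completion (K := ℚ) (Sum.inr ((Rat.HeightOneSpectrum.primesEquiv (R := 𝓞 ℚ)).symm ⟨p, Fact.out⟩))) (L := (w₀.1.adicCompletion (CyclotomicField (cycLevel p k r) ℚ))) δ'
  choose s hs using hconj
  have hcont₀ : Continuous (algebraMap (NumberField.Place.Completion (K := ℚ) (Sum.inr ((Rat.HeightOneSpectrum.primesEquiv (R := 𝓞 ℚ)).symm ⟨p, Fact.out⟩))) (w₀.1.adicCompletion (CyclotomicField (cycLevel p k r) ℚ))) := continuous_algebraMap (((Rat.HeightOneSpectrum.primesEquiv (R := 𝓞 ℚ)).symm ⟨p, Fact.out⟩).adicCompletion ℚ) (w₀.1.adicCompletion (CyclotomicField (cycLevel p k r) ℚ))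
  haveI hSTp₀ : IsScalarTower ℚ_[p] (NumberField.Place.Completion (K := ℚ) (Sum.inr ((Rat.HeightOneSpectrum.primesEquiv (R := 𝓞 ℚ)).symm ⟨p, Fact.out⟩))) (w₀.1.adicCompletion (CyclotomicField (cycLevel p k r) ℚ)) :=
    isScalarTower_padicAlgebra_of_continuous p hcont₀ (valuation_place_lt_one p ((Rat.HeightOneSpectrum.primesEquiv (R := 𝓞 ℚ)).symm ⟨p, Fact.out⟩)) (LocalField.valuation_adicCompletion_natCast_lt_one w₀.1 p hw₀)
  -- one class with `exp*_d ≠ 0`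
  obtain ⟨y₁, hy₁⟩ := hne
  have hh₀ : expStarOmega (valuation_place_lt_one p ((Rat.HeightOneSpectrum.primesEquiv (R := 𝓞 ℚ)).symm ⟨p, Fact.out⟩)) (galRestrictPlace ((Rat.HeightOneSpectrum.primesEquiv (R := 𝓞 ℚ)).symm ⟨p, Fact.out⟩)) d y₁ ≠ 0 := hy₁
  -- (GAL_loc) at `w₀` is kim3's `expStarOmega_galois`, fed INLINE below (an explicit `have` of its type times out)
  -- (GAL₀) at `w₀` for `F₀ := exp*_{w₀} ∘ loc^{tower}_{w₀} ∘ H1toInt` (every `δ ∈ Γ_ℚ` fixing `w₀`)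
  have hgalD := galD_of_galLoc W p k r w₀ (absGaloisRestrictTower_adicCompletion_mem_cycSubgroup_prime p k r w₀)
    (expStarOmegaHom (LocalField.valuation_adicCompletion_natCast_lt_one w₀.1 p hw₀) ((galRestrictPlace ((Rat.HeightOneSpectrum.primesEquiv (R := 𝓞 ℚ)).symm ⟨p, Fact.out⟩)).comp (absGaloisRestrict (((Rat.HeightOneSpectrum.primesEquiv (R := 𝓞 ℚ)).symm ⟨p, Fact.out⟩).adicCompletion ℚ) (w₀.1.adicCompletion (CyclotomicField (cycLevel p k r) ℚ)))) dw₀ hinjw₀ hexw₀) (fun δ' τ => s δ' τ) hs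
    (fun δ' hδ c c' hc' =>
      expStarOmega_galois (K := NumberField.Place.Completion (K := ℚ) (Sum.inr ((Rat.HeightOneSpectrum.primesEquiv (R := 𝓞 ℚ)).symm ⟨p, Fact.out⟩))) (L := (w₀.1.adicCompletion (CyclotomicField (cycLevel p k r) ℚ))) (p := p)
        (valuation_place_lt_one p ((Rat.HeightOneSpectrum.primesEquiv (R := 𝓞 ℚ)).symm ⟨p, Fact.out⟩)) (LocalField.valuation_adicCompletion_natCast_lt_one w₀.1 p hw₀) W (galRestrictPlace ((Rat.HeightOneSpectrum.primesEquiv (R := 𝓞 ℚ)).symm ⟨p, Fact.out⟩)) hcont₀ δ' (s δ') (hs δ')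
        (galAdicCompletionMap _ hδ)
        (fun x => galAdicCompletionMap_algebraMap_adicCompletion _ _ w₀ w₀ hδ x)
        (fun y x hyx => absClosureEmbedding_smul_eq_galAdicCompletionMap p k r w₀ δ' hδ y x hyx)
        d dw₀ hinjw₀ hexw₀ (fun y => hres₀ y) y₁ hh₀ c c' (fun τ => hc' τ))
  have hgalD' := fun δ' hδ' Y' =>
    ((expStarTowerMap_apply W p k r w₀ hw₀ dw₀ hinjw₀ hexw₀ _).trans (hgalD δ' hδ' Y')).trans
      (congrArg (galAdicCompletionMap _ hδ') (expStarTowerMap_apply W p k r w₀ hw₀ dw₀ hinjw₀ hexw₀ Y').symm)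
  have hGAL0 : ∀ (δ : absoluteGaloisGroup ℚ)
      (hδ : sigma (cycLevel p k r) (modNCyclotomicCharacter ℚ (cycLevel p k r) δ) • w₀.1 = w₀.1)
      (Y : H1 (tateRep W p) (cycSubgroup p k r)),
      expStarTowerMap W p k r w₀ hw₀ dw₀ hinjw₀ hexw₀ (conjMap (tateRep W p).toTopRep (cycSubgroup p k r) δ 1 Y) =
        galAdicCompletionMap (sigma (cycLevel p k r) (modNCyclotomicCharacter ℚ (cycLevel p k r) δ)) hδ
          (expStarTowerMap W p k r w₀ hw₀ dw₀ hinjw₀ hexw₀ Y) := fun δ hδ Y =>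
    singleField_gal_of_galDecomposition_all p k r W w₀ (expStarTowerMap W p k r w₀ hw₀ dw₀ hinjw₀ hexw₀)
      (fun δ' hδ' Y' => hgalD' δ' hδ' Y') δ hδ Y
  -- (C3a) for `Λ₀ := katoLambda … w₀ …` (every `σ ∈ Γ_ℚ`)
  have hC3a : ∀ (σ : absoluteGaloisGroup ℚ) (y : H1 (tateRep W p) (cycSubgroup p k r)),
      katoLambda W p k r w₀ Ψ hΨ hw₀ g₀ hg₀ dw₀ hinjw₀ hexw₀ (conjMap (tateRep W p).toTopRep (cycSubgroup p k r) σ 1 y) =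
        Algebra.TensorProduct.map (AlgHom.id ℚ ℚ_[p])
          (sigma (cycLevel p k r) (modNCyclotomicCharacter ℚ (cycLevel p k r) σ) :
            CyclotomicField (cycLevel p k r) ℚ →ₐ[ℚ] CyclotomicField (cycLevel p k r) ℚ)
          (katoLambda W p k r w₀ Ψ hΨ hw₀ g₀ hg₀ dw₀ hinjw₀ hexw₀ y) :=
    zetaBody_C3a_of_cocycleDef_of_galLoc W p k r w₀
      (absGaloisRestrictTower_adicCompletion_mem_cycSubgroup_prime p k r w₀)
      (expStarOmegaHom (LocalField.valuation_adicCompletion_natCast_lt_one w₀.1 p hw₀) ((galRestrictPlace ((Rat.HeightOneSpectrum.primesEquiv (R := 𝓞 ℚ)).symm ⟨p, Fact.out⟩)).comp (absGaloisRestrict (((Rat.HeightOneSpectrum.primesEquiv (R := 𝓞 ℚ)).symm ⟨p, Fact.out⟩).adicCompletion ℚ) (w₀.1.adicCompletion (CyclotomicField (cycLevel p k r) ℚ)))) dw₀ hinjw₀ hexw₀)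
      (katoLambda W p k r w₀ Ψ hΨ hw₀ g₀ hg₀ dw₀ hinjw₀ hexw₀) Ψ hΨ g₀ hg₀
      (fun w y φ'' ψT hφ'' hψT => cocycleDef_katoLambda W p k r w₀ Ψ hΨ hw₀ g₀ hg₀ dw₀ hinjw₀ hexw₀ w y φ'' ψT hφ'' hψT)
      (fun δ' τ => s δ' τ) hs
      (fun δ' hδ c c' hc' =>
        expStarOmega_galois (K := NumberField.Place.Completion (K := ℚ) (Sum.inr ((Rat.HeightOneSpectrum.primesEquiv (R := 𝓞 ℚ)).symm ⟨p, Fact.out⟩))) (L := (w₀.1.adicCompletion (CyclotomicField (cycLevel p k r) ℚ))) (p := p)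
          (valuation_place_lt_one p ((Rat.HeightOneSpectrum.primesEquiv (R := 𝓞 ℚ)).symm ⟨p, Fact.out⟩)) (LocalField.valuation_adicCompletion_natCast_lt_one w₀.1 p hw₀) W (galRestrictPlace ((Rat.HeightOneSpectrum.primesEquiv (R := 𝓞 ℚ)).symm ⟨p, Fact.out⟩)) hcont₀ δ' (s δ') (hs δ')
          (galAdicCompletionMap _ hδ)
          (fun x => galAdicCompletionMap_algebraMap_adicCompletion _ _ w₀ w₀ hδ x)
          (fun y x hyx => absClosureEmbedding_smul_eq_galAdicCompletionMap p k r w₀ δ' hδ y x hyx)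
          d dw₀ hinjw₀ hexw₀ (fun y => hres₀ y) y₁ hh₀ c c' (fun τ => hc' τ))
  -- the place change of `exp* ∘ loc^{tower}`
  have hpc := expStarTowerMap_placeChange W p k r w₀ w₁ hw₀ hw₁ d hinj hex ⟨y₁, hy₁⟩ dw₀ hinjw₀ hexw₀ hres₀ dw₁ hinjw₁ hexw₁ hres₁
  obtain ⟨γ, hγ, hF⟩ := hpc
  exact ⟨γ, hγ, fun y => eq_map_of_components W p k r Ψ hΨ w₀ w₁ g₀ hg₀ g₁ hg₁
    (expStarTowerMap W p k r w₀ hw₀ dw₀ hinjw₀ hexw₀) (expStarTowerMap W p k r w₁ hw₁ dw₁ hinjw₁ hexw₁)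
    (katoLambda W p k r w₀ Ψ hΨ hw₀ g₀ hg₀ dw₀ hinjw₀ hexw₀) (katoLambda W p k r w₁ Ψ hΨ hw₁ g₁ hg₁ dw₁ hinjw₁ hexw₁)
    (apply_katoLambda W p k r w₀ Ψ hΨ hw₀ g₀ hg₀ dw₀ hinjw₀ hexw₀) (apply_katoLambda W p k r w₁ Ψ hΨ hw₁ g₁ hg₁ dw₁ hinjw₁ hexw₁)
    hGAL0 hC3a γ hγ hF y⟩

end PlaceChange

end Summit.BirchSwinnertonDyer.BirchSwinnertonDyer.Theorems.KimAtThreeFineKatoPlaceChange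

end
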